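import Mathlib.GroupTheory.Perm.Fin
import Summits.CriticalPhenomena.PercolationContinuityZ3.Theorems.PercNearOneGluingNoHeavyLowerTailSahiGridPatternCaterpillarDefs
import Summits.CriticalPhenomena.PercolationContinuityZ3.Theorems.PercNearOneGluingNoHeavyLowerTailSahiGridPatternLiteralSteps
import Summits.CriticalPhenomena.PercolationContinuityZ3.Theorems.PercNearOneGluingNoHeavyLowerTailSahiGridPatternStarLiteralGeneral

/-!
# `NoHeavyLowerTail` (crux stmt-CriticalPhenomena-4575), Sahi programme P1: **CATERPILLARS GROWN FROM AN OR OF TWO ANDS** —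
# Kahn's `E₃(1_A,1_B,1_C) ≥ 0` for `A` a caterpillar read-once formula over a two-orthant seed `x_{S₁} ≥ c ∨ x_{S₂} ≥ c`

Support file (Sahi cell, seat `prim-sahi-p1`, generation 26; `--supports stmt-CriticalPhenomena-4575`).  Pure proofs, no definitions,
no `sorry`, standard axioms.  Sequel of `…SahiGridPatternCaterpillar` (seeds `⊤`, `∅`): here the innermost constant of the caterpillar
formula is replaced by the OR OF TWO MONOMIALS on fresh coordinates (`sStarD_twoOrthant_union_nonneg`, generation 21, good in every
position), so that e.g. `x₁ ∧ (x₂x₃ ∨ x₄x₅)`, `x₆ ∨ (x₁ ∧ (x₂x₃ ∨ x₄x₅))`, `(x₂x₃ ∨ x₄x₅ ∨ x₆ ∨ x₇) ∧ x₈` are covered.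
* `sStarD_twoOrthantSeed_nonneg` — the seed alone (thresholds in `Option (Fin 3)`, degenerate blocks allowed) is a good first slot in every position.
* **`sStarD_caterpillarSeed_nonneg`** (pattern level, every `d`): literals `litVal (thr i)` on axes `σ i`, seed literals `litVal (sthr j)`
  on axes `ρ j` split into two blocks by `κ`, all axes distinct: the set `{y : catEval K ops (lits y) (seed y)}` is a good first slot.
* VALUE LEVEL (`Ssym_nonneg_caterpillarSeed`, `latticeE3_gridProd_nonneg_caterpillarSeed`, **`sahiE_three_caterpillarSeed_nonneg`**):
  for every product probability weight on every grid `[K'+1]^d` and all increasing `B, C`: `0 ≤ E₃(1_A, 1_B, 1_C)` for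
  `A = {x : F(x)}`, `F = ℓ₀ ⋄₀ (ℓ₁ ⋄₁ ( ⋯ (ℓ_{K-1} ⋄_{K-1} (M₁ ∨ M₂))))`, `ℓ_i = [c_i ≤ x_{σ i}]`, `M₁, M₂` monomials of threshold literals
  on the two blocks of `ρ` — this contains the clause ∨ two-monomials theorem (`sahiE_three_clauseTwoOrthant_nonneg`) and the
  caterpillar theorem.  NOT covered: three wide monomials at the root (`x₁x₂ ∨ x₃x₄ ∨ x₅x₆`, Conjecture Λ).
Nothing here asserts `PatternPos d` for `d ≥ 4`. [this work]
-/

namespace Summit.CriticalPhenomena.PercolationContinuityZ3.Theorems.SahiGridPattern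

open Finset SahiGrid3 Literature.Probability.LatticeModels Literature.Combinatorics.Sahi2008
open scoped BigOperators

/-- A caterpillar formula is monotone in its literal values and in its seed. [this work] -/
theorem catEval_mono₂ : ∀ (K : ℕ) (ops : Fin K → Bool) {v v' : Fin K → Bool} {w w' : Bool},
    (∀ i, v i = true → v' i = true) → (w = true → w' = true) → catEval K ops v w = true → catEval K ops v' w' = true
  | 0 => by
      intro ops v v' w w' _ hw h
      rw [catEval_zero] at h ⊢
      exact hw h
  | K + 1 => by
      intro ops v v' w w' hv hw h
      have ih := catEval_mono₂ K (fun j => ops j.succ) (v := fun j => v j.succ) (v' := fun j => v' j.succ)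
        (fun j hj => hv _ hj) hw
      rw [catEval_succ] at h ⊢
      by_cases h0 : ops 0 = true
      · rw [if_pos h0, Bool.or_eq_true] at h ⊢
        rcases h with h | h
        · exact Or.inl (hv 0 h)
        · exact Or.inr (ih h)
      · rw [if_neg h0, Bool.and_eq_true] at h ⊢
        exact ⟨hv 0 h.1, ih h.2⟩

/-! ### The seed: an OR of two ANDs of threshold literals, in every position -/

/-- **The two-orthant seed is good in every position** (thresholds in `Option (Fin 3)`: a block containing a never-true literal is empty).
[this work] -/
theorem sStarD_twoOrthantSeed_nonneg {K₀ d : ℕ} (κ : Fin K₀ → Bool) (sthr : Fin K₀ → Option (Fin 3))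
    (ρ : Fin K₀ → Fin d) (hρ : Function.Injective ρ) {A : Finset (Pd d)}
    (hA : ∀ y : Pd d, y ∈ A ↔ ((∀ j, κ j = true → litVal (sthr j) (y (ρ j)) = true) ∨ (∀ j, κ j = false → litVal (sthr j) (y (ρ j)) = true)))
    (B C : Finset (Pd d)) (hB : IsUpperSet (B : Set (Pd d))) (hC : IsUpperSet (C : Set (Pd d))) : 0 ≤ sStarD A B C := by
  classical
  -- thresholds read on the axes of `[3]^d` (value `0` off the image of `ρ`)
  set tval : Fin K₀ → Fin 3 := fun j => (sthr j).getD 0 with htval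
  have hinv : ∀ a : Fin d, ∀ h : ∃ j, ρ j = a, ∀ j, ρ j = a → h.choose = j := fun a h j hj => hρ (h.choose_spec.trans hj.symm)
  have key : ∀ (b : Bool) (y : Pd d), (¬ ∃ j, κ j = b ∧ sthr j = none) →
      ((∀ j, κ j = b → litVal (sthr j) (y (ρ j)) = true) ↔
        ∀ a ∈ (univ.filter fun j => κ j = b).image ρ, (if h : ∃ j, ρ j = a then tval h.choose else 0) ≤ y a) := by
    intro b y hnone
    rw [Finset.forall_mem_image]
    constructor
    · intro h j hj
      rw [Finset.mem_filter] at hj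
      have ex : ∃ j', ρ j' = ρ j := ⟨j, rfl⟩
      rw [dif_pos ex, hinv _ ex j rfl]
      have hl := h j hj.2
      rcases hs : sthr j with _ | t
      · exact absurd ⟨j, hj.2, hs⟩ hnone
      · rw [hs, litVal_some, decide_eq_true_iff] at hl
        rw [htval]; simp only [hs, Option.getD_some]; exact hl
    · intro h j hj
      have hm : j ∈ univ.filter fun j => κ j = b := Finset.mem_filter.2 ⟨Finset.mem_univ _, hj⟩
      have hl := h hm
      have ex : ∃ j', ρ j' = ρ j := ⟨j, rfl⟩
      rw [dif_pos ex, hinv _ ex j rfl] at hl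
      rcases hs : sthr j with _ | t
      · exact absurd ⟨j, hj, hs⟩ hnone
      · rw [litVal_some, decide_eq_true_iff]
        rw [htval] at hl; simp only [hs, Option.getD_some] at hl; exact hl
  have dead : ∀ (b : Bool) (y : Pd d), (∃ j, κ j = b ∧ sthr j = none) → ¬ (∀ j, κ j = b → litVal (sthr j) (y (ρ j)) = true) := by
    rintro b y ⟨j, hj, hs⟩ h
    have := h j hj
    rw [hs, litVal_none] at this
    exact Bool.false_ne_true this
  by_cases h1 : ∃ j, κ j = true ∧ sthr j = none
  · by_cases h2 : ∃ j, κ j = false ∧ sthr j = none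
    · -- both blocks dead: `A = ∅`
      have e : A = ∅ := Finset.eq_empty_of_forall_notMem fun y hy => by
        rcases (hA y).1 hy with h | h
        · exact dead true y h1 h
        · exact dead false y h2 h
      rw [e, sStarD_empty_left]
    · -- block 1 dead: a single orthant
      set p : Pd d := fun a => if a ∈ (univ.filter fun j => κ j = false).image ρ then
        (if h : ∃ j, ρ j = a then tval h.choose else 0) else 0 with hp
      have e : A = univ.filter fun y : Pd d => ∀ a, p a ≤ y a := by
        ext y
        rw [hA y, Finset.mem_filter, or_iff_right (dead true y h1), key false y h2]
        simp only [Finset.mem_univ, true_and]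
        constructor
        · intro h a
          rw [hp]; dsimp only
          by_cases ha : a ∈ (univ.filter fun j => κ j = false).image ρ
          · rw [if_pos ha]; exact h a ha
          · rw [if_neg ha]; exact Fin.zero_le _
        · intro h a ha
          have := h a
          rw [hp] at this; dsimp only at this; rw [if_pos ha] at this; exact this
      rw [e]; exact sStarD_principal_nonneg d p B C hB hC
  · by_cases h2 : ∃ j, κ j = false ∧ sthr j = none
    · -- block 2 dead: a single orthant
      set p : Pd d := fun a => if a ∈ (univ.filter fun j => κ j = true).image ρ then
        (if h : ∃ j, ρ j = a then tval h.choose else 0) else 0 with hp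
      have e : A = univ.filter fun y : Pd d => ∀ a, p a ≤ y a := by
        ext y
        rw [hA y, Finset.mem_filter, or_iff_left (dead false y h2), key true y h1]
        simp only [Finset.mem_univ, true_and]
        constructor
        · intro h a
          rw [hp]; dsimp only
          by_cases ha : a ∈ (univ.filter fun j => κ j = true).image ρ
          · rw [if_pos ha]; exact h a ha
          · rw [if_neg ha]; exact Fin.zero_le _
        · intro h a ha
          have := h a
          rw [hp] at this; dsimp only at this; rw [if_pos ha] at this; exact this
      rw [e]; exact sStarD_principal_nonneg d p B C hB hC
    · -- both blocks alive: the two-orthant theorem in general position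
      have hdisj : Disjoint ((univ.filter fun j => κ j = true).image ρ) ((univ.filter fun j => κ j = false).image ρ) := by
        rw [Finset.disjoint_image hρ, Finset.disjoint_filter]
        intro j _ h; rw [h]; decide
      have e : A = univ.filter fun y : Pd d =>
          (∀ a ∈ (univ.filter fun j => κ j = true).image ρ, (fun a => if h : ∃ j, ρ j = a then tval h.choose else 0) a ≤ y a) ∨
          (∀ a ∈ (univ.filter fun j => κ j = false).image ρ, (fun a => if h : ∃ j, ρ j = a then tval h.choose else 0) a ≤ y a) := by
        ext y
        rw [hA y, Finset.mem_filter, key true y h1, key false y h2]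
        simp only [Finset.mem_univ, true_and]
      rw [e]
      exact sStarD_twoOrthant_union_nonneg _ _ hdisj _ _ hB hC

/-! ### Pattern level: caterpillars over the seed -/

/-- **THE CATERPILLAR-OVER-TWO-MONOMIALS PATTERN THEOREM** (every `d`): literals `litVal (thr i)` on distinct axes `σ i`, combined from the
outside in by `ops` down to the two-orthant seed on the (further, distinct) axes `ρ j` (blocks `κ`, thresholds `sthr`): the set cut out is a
good first slot of `[3]^d`. [this work] -/
theorem sStarD_caterpillarSeed_nonneg : ∀ (K : ℕ) (ops : Fin K → Bool) (thr : Fin K → Option (Fin 3))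
    {K₀ : ℕ} (κ : Fin K₀ → Bool) (sthr : Fin K₀ → Option (Fin 3))
    (d : ℕ) (σ : Fin K → Fin d) (ρ : Fin K₀ → Fin d), Function.Injective σ → Function.Injective ρ → (∀ i j, σ i ≠ ρ j) →
    ∀ A : Finset (Pd d), (∀ y : Pd d, y ∈ A ↔ catEval K ops (fun i => litVal (thr i) (y (σ i)))
      (decide ((∀ j, κ j = true → litVal (sthr j) (y (ρ j)) = true) ∨ (∀ j, κ j = false → litVal (sthr j) (y (ρ j)) = true))) = true) →
    ∀ B C : Finset (Pd d), IsUpperSet (B : Set (Pd d)) → IsUpperSet (C : Set (Pd d)) → 0 ≤ sStarD A B C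
  | 0 => by
      intro ops thr K₀ κ sthr d σ ρ _ hρ _ A hA B C hB hC
      refine sStarD_twoOrthantSeed_nonneg κ sthr ρ hρ (fun y => ?_) B C hB hC
      rw [hA y, catEval_zero, decide_eq_true_iff]
  | K + 1 => by
      intro ops thr K₀ κ sthr d σ ρ hσ hρ hσρ A hA B C hB hC
      cases d with
      | zero => exact Fin.elim0 (σ 0)
      | succ d' =>
      classical
      set ops' : Fin K → Bool := fun j => ops j.succ with hops'
      set thr' : Fin K → Option (Fin 3) := fun j => thr j.succ with hthr'
      set p : Fin (d' + 1) := σ 0 with hp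
      -- the seed value at a point
      set sd : Pd (d' + 1) → Bool := fun x =>
        decide ((∀ j, κ j = true → litVal (sthr j) (x (ρ j)) = true) ∨ (∀ j, κ j = false → litVal (sthr j) (x (ρ j)) = true)) with hsd
      have hσ' : Function.Injective (fun j : Fin K => σ j.succ) := fun j j' h => Fin.succ_injective _ (hσ h)
      have hmemA : ∀ x : Pd (d' + 1), x ∈ A ↔ (if ops 0 = true then
          litVal (thr 0) (x p) || catEval K ops' (fun j => litVal (thr' j) (x (σ j.succ))) (sd x)
          else litVal (thr 0) (x p) && catEval K ops' (fun j => litVal (thr' j) (x (σ j.succ))) (sd x)) = true := fun x => by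
        rw [hA x, catEval_succ]
      have hinner : ∀ A₁ : Finset (Pd (d' + 1)),
          (∀ x : Pd (d' + 1), x ∈ A₁ ↔ catEval K ops' (fun j => litVal (thr' j) (x (σ j.succ))) (sd x) = true) →
          0 ≤ sStarD A₁ B C := fun A₁ hA₁ =>
        sStarD_caterpillarSeed_nonneg K ops' thr' κ sthr (d' + 1) (fun j => σ j.succ) ρ hσ' hρ (fun i j => hσρ _ _) A₁
          (fun x => by rw [hA₁ x]) B C hB hC
      -- remove the axis `p`: inner literal axes `g`, seed axes `ρ'`
      have hg : ∀ j : Fin K, ∃ i : Fin d', p.succAbove i = σ j.succ := fun j =>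
        Fin.exists_succAbove_eq (fun h => Fin.succ_ne_zero j (hσ (h.trans hp)))
      choose g hg using hg
      have hginj : Function.Injective g := fun j j' h => by
        have e := congrArg p.succAbove h
        rw [hg, hg] at e
        exact Fin.succ_injective _ (hσ e)
      have hr : ∀ j : Fin K₀, ∃ i : Fin d', p.succAbove i = ρ j := fun j =>
        Fin.exists_succAbove_eq (fun h => hσρ 0 j (hp.symm.trans h.symm))
      choose ρ' hρ' using hr
      have hρ'inj : Function.Injective ρ' := fun j j' h => by
        have e := congrArg p.succAbove h
        rw [hρ', hρ'] at e
        exact hρ e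
      have hgρ' : ∀ i j, g i ≠ ρ' j := fun i j h => by
        have e := congrArg p.succAbove h
        rw [hg, hρ'] at e
        exact hσρ _ _ e
      set sd' : Pd d' → Bool := fun z =>
        decide ((∀ j, κ j = true → litVal (sthr j) (z (ρ' j)) = true) ∨ (∀ j, κ j = false → litVal (sthr j) (z (ρ' j)) = true)) with hsd'
      set U' : Finset (Pd d') := univ.filter fun z : Pd d' => catEval K ops' (fun j => litVal (thr' j) (z (g j))) (sd' z) = true with hU'
      have hU'mem : ∀ z : Pd d', z ∈ U' ↔ catEval K ops' (fun j => litVal (thr' j) (z (g j))) (sd' z) = true := fun z => by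
        rw [hU', Finset.mem_filter]; simp
      have hgood : ∀ P R : Finset (Pd d'), IsUpperSet (P : Set (Pd d')) → IsUpperSet (R : Set (Pd d')) → 0 ≤ sStarD U' P R :=
        sStarD_caterpillarSeed_nonneg K ops' thr' κ sthr d' g ρ' hginj hρ'inj hgρ' U' (fun z => by rw [hU'mem z])
      have hsd'mono : ∀ z z' : Pd d', z ≤ z' → sd' z = true → sd' z' = true := by
        intro z z' hle h
        rw [hsd', decide_eq_true_iff] at h ⊢
        rcases h with h | h
        · exact Or.inl fun j hj => litVal_mono (hle (ρ' j)) (h j hj)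
        · exact Or.inr fun j hj => litVal_mono (hle (ρ' j)) (h j hj)
      have hU'up : IsUpperSet (U' : Set (Pd d')) := by
        intro z z' hle hz
        rw [Finset.mem_coe, hU'mem] at hz ⊢
        exact catEval_mono₂ K ops' (fun j hj => litVal_mono (hle (g j)) hj) (hsd'mono z z' hle) hz
      let ε : Fin (1 + d') ≃ Fin (d' + 1) := (finCongr (Nat.add_comm 1 d')).trans p.cycleRange.symm
      have hε0 : ε (Fin.castAdd d' (0 : Fin 1)) = p := by
        show p.cycleRange.symm (finCongr _ (Fin.castAdd d' 0)) = p
        have e : finCongr (Nat.add_comm 1 d') (Fin.castAdd d' (0 : Fin 1)) = 0 := Fin.ext (by simp)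
        rw [e, Fin.cycleRange_symm_zero]
      have hε1 : ∀ i : Fin d', ε (Fin.natAdd 1 i) = p.succAbove i := fun i => by
        show p.cycleRange.symm (finCongr _ (Fin.natAdd 1 i)) = _
        have e : finCongr (Nat.add_comm 1 d') (Fin.natAdd 1 i) = i.succ := Fin.ext (by simp)
        rw [e, Fin.cycleRange_symm_succ]
      have hhead : ∀ x : Pd (d' + 1), (x ∘ ε) (Fin.castAdd d' (0 : Fin 1)) = x p := fun x => by
        rw [Function.comp_apply, hε0]
      have hsdcell : ∀ x : Pd (d' + 1), sd' (cellOf (n := 1) (x ∘ ε)) = sd x := fun x => by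
        simp only [hsd', hsd, cellOf, Function.comp_apply, hε1, hρ']
      have hcell' : ∀ x : Pd (d' + 1), cellOf (n := 1) (x ∘ ε) ∈ U' ↔
          catEval K ops' (fun j => litVal (thr' j) (x (σ j.succ))) (sd x) = true := fun x => by
        rw [hU'mem, hsdcell]
        have e : (fun j => litVal (thr' j) (cellOf (n := 1) (x ∘ ε) (g j))) = fun j => litVal (thr' j) (x (σ j.succ)) := by
          funext j
          simp only [cellOf, Function.comp_apply, hε1, hg]
        rw [e]
      rcases hthr0 : thr 0 with _ | t
      · by_cases h0 : ops 0 = true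
        · refine hinner A fun x => ?_
          rw [hmemA x, if_pos h0, hthr0, litVal_none, Bool.false_or]
        · have e : A = ∅ := Finset.eq_empty_of_forall_notMem fun x hx => by
            have h := (hmemA x).1 hx
            rw [if_neg h0, hthr0, litVal_none, Bool.false_and] at h
            exact Bool.false_ne_true h
          rw [e, sStarD_empty_left]
      · by_cases ht : t = 0
        · subst ht
          by_cases h0 : ops 0 = true
          · have e : A = univ := Finset.eq_univ_of_forall fun x => by
              rw [hmemA x, if_pos h0, hthr0, litVal_some_zero, Bool.true_or]
            rw [e]; exact sStarD_nonneg_of_eq_univ₁ hB hC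
          · refine hinner A fun x => ?_
            rw [hmemA x, if_neg h0, hthr0, litVal_some_zero, Bool.true_and]
        · by_cases h0 : ops 0 = true
          · set A'' : Finset (Pd (1 + d')) := univ.filter fun u : Pd (1 + d') =>
              t ≤ u (Fin.castAdd d' (0 : Fin 1)) ∨ cellOf (n := 1) u ∈ U' with hA''
            have hglue : ∀ (ξ : Pd 1) (z : Pd d'), glue ξ z ∈ A'' ↔ t ≤ ξ 0 ∨ z ∈ U' := fun ξ z => by
              rw [hA'', Finset.mem_filter, glue_castAdd, cellOf_glue]; simp
            have hgood'' := sStarD_nonneg_literalOr_of_good t ht hU'up hgood hglue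
            refine sStarD_nonneg_transfer ε hgood'' (fun x => ?_) B C hB hC
            rw [hmemA x, if_pos h0, hthr0, litVal_some, Bool.or_eq_true, decide_eq_true_iff, hA'', Finset.mem_filter, hhead x, hcell' x]
            simp
          · set A'' : Finset (Pd (1 + d')) := univ.filter fun u : Pd (1 + d') =>
              t ≤ u (Fin.castAdd d' (0 : Fin 1)) ∧ cellOf (n := 1) u ∈ U' with hA''
            have hglue : ∀ (ξ : Pd 1) (z : Pd d'), glue ξ z ∈ A'' ↔ t ≤ ξ 0 ∧ z ∈ U' := fun ξ z => by
              rw [hA'', Finset.mem_filter, glue_castAdd, cellOf_glue]; simp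
            have hgood'' := sStarD_nonneg_literalAnd_of_good t ht hU'up hgood hglue
            refine sStarD_nonneg_transfer ε hgood'' (fun x => ?_) B C hB hC
            rw [hmemA x, if_neg h0, hthr0, litVal_some, Bool.and_eq_true, decide_eq_true_iff, hA'', Finset.mem_filter, hhead x, hcell' x]
            simp


/-! ### Value level: Kahn's inequality for a caterpillar grown from an OR of two monomials -/

variable {d K' : ℕ}

/-- `decide` respects logical equivalence (bookkeeping for the pulled-back literals). [this work] -/
private theorem decide_congr_iff' {P Q : Prop} [Decidable P] [Decidable Q] (h : P ↔ Q) : decide P = decide Q := by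
  rcases Decidable.em Q with hq | hq
  · rw [decide_eq_true (h.2 hq), decide_eq_true hq]
  · rw [decide_eq_false (fun hp => hq (h.1 hp)), decide_eq_false hq]

/-- **The symmetrised pattern value of (caterpillar-over-two-monomials event, up-set, up-set) is nonnegative** at every three-point
sample `ω` of the grid: after sorting, every literal (of the chain and of the seed) pulls back to a threshold literal of the small cube on the
same axis, with threshold in `Option (Fin 3)`. [this work] -/
theorem Ssym_nonneg_caterpillarSeed (K : ℕ) (ops : Fin K → Bool) (c : Fin K → Fin (K' + 1)) (σ : Fin K → Fin d)
    {K₀ : ℕ} (κ : Fin K₀ → Bool) (cs : Fin K₀ → Fin (K' + 1)) (ρ : Fin K₀ → Fin d)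
    (hσ : Function.Injective σ) (hρ : Function.Injective ρ) (hσρ : ∀ i j, σ i ≠ ρ j)
    {B C : Finset (Xd d K')} (hB : IsUpperSet (B : Set (Xd d K'))) (hC : IsUpperSet (C : Set (Xd d K'))) (ω : Fin 3 → Xd d K') :
    0 ≤ Ssym (univ.filter fun x : Xd d K' => catEval K ops (fun i => decide (c i ≤ x (σ i)))
      (decide ((∀ j, κ j = true → cs j ≤ x (ρ j)) ∨ (∀ j, κ j = false → cs j ≤ x (ρ j)))) = true) B C ω := by
  classical
  set A : Finset (Xd d K') := univ.filter fun x : Xd d K' => catEval K ops (fun i => decide (c i ≤ x (σ i)))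
      (decide ((∀ j, κ j = true → cs j ≤ x (ρ j)) ∨ (∀ j, κ j = false → cs j ≤ x (ρ j)))) = true with hAdef
  let π : Fin d → Equiv.Perm (Fin 3) := fun a => Tuple.sort fun cc => ω cc a
  have hsort : ∀ a, Monotone fun cc => Tmap π ω cc a := fun a => by
    show Monotone ((fun cc => ω cc a) ∘ π a)
    exact Tuple.monotone_sort _
  rw [← S_Tmap A B C π ω, S_eq_sStarD]
  set ω' : Fin 3 → Xd d K' := Tmap π ω with hω'
  have hB' := isUpperSet_pb hsort hB
  have hC' := isUpperSet_pb hsort hC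
  have ht : ∀ (a : Fin d) (cc0 : Fin (K' + 1)), ∃ o : Option (Fin 3), ∀ cc : Fin 3, (cc0 ≤ ω' cc a ↔ litVal o cc = true) := by
    intro a cc0
    rcases threshold_three_le (fun cc => ω' cc a) (hsort a) cc0 with h | ⟨t, h⟩
    · exact ⟨none, fun cc => by rw [litVal_none]; simpa using h cc⟩
    · exact ⟨some t, fun cc => by rw [litVal_some, decide_eq_true_iff]; exact h cc⟩
  choose th hth using ht
  have mem_pb : ∀ q : Pd d, q ∈ pb ω' A ↔ catEval K ops (fun i => litVal (th (σ i) (c i)) (q (σ i)))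
      (decide ((∀ j, κ j = true → litVal (th (ρ j) (cs j)) (q (ρ j)) = true) ∨
        (∀ j, κ j = false → litVal (th (ρ j) (cs j)) (q (ρ j)) = true))) = true := by
    intro q
    unfold pb
    rw [Finset.mem_filter, hAdef, Finset.mem_filter]
    have e1 : (fun i => decide (c i ≤ ω' (q (σ i)) (σ i))) = fun i => litVal (th (σ i) (c i)) (q (σ i)) := by
      funext i
      rw [decide_congr_iff' (hth (σ i) (c i) (q (σ i)))]
      cases litVal (th (σ i) (c i)) (q (σ i)) <;> simp
    have e2 : ((∀ j, κ j = true → cs j ≤ ω' (q (ρ j)) (ρ j)) ∨ (∀ j, κ j = false → cs j ≤ ω' (q (ρ j)) (ρ j))) ↔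
        ((∀ j, κ j = true → litVal (th (ρ j) (cs j)) (q (ρ j)) = true) ∨ (∀ j, κ j = false → litVal (th (ρ j) (cs j)) (q (ρ j)) = true)) := by
      simp only [hth]
    simp only [Finset.mem_univ, true_and, e1, decide_congr_iff' e2]
  exact sStarD_caterpillarSeed_nonneg K ops (fun i => th (σ i) (c i)) κ (fun j => th (ρ j) (cs j)) d σ ρ hσ hρ hσρ (pb ω' A) mem_pb _ _ hB' hC'

/-- **SAHI'S `C₃` / KAHN'S INEQUALITY WITH A CATERPILLAR-OVER-TWO-MONOMIALS SLOT ON EVERY GRID, homogeneous form** (every `d, K'`). [this work] -/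
theorem latticeE3_gridProd_nonneg_caterpillarSeed (g : Fin d → Fin (K' + 1) → ℝ) (hg : ∀ a v, 0 ≤ g a v)
    (K : ℕ) (ops : Fin K → Bool) (c : Fin K → Fin (K' + 1)) (σ : Fin K → Fin d)
    {K₀ : ℕ} (κ : Fin K₀ → Bool) (cs : Fin K₀ → Fin (K' + 1)) (ρ : Fin K₀ → Fin d)
    (hσ : Function.Injective σ) (hρ : Function.Injective ρ) (hσρ : ∀ i j, σ i ≠ ρ j)
    {B C : Finset (Xd d K')} (hB : IsUpperSet (B : Set (Xd d K'))) (hC : IsUpperSet (C : Set (Xd d K'))) :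
    0 ≤ latticeE3 (fun ω : Xd d K' => ∏ a, g a (ω a))
      (univ.filter fun x : Xd d K' => catEval K ops (fun i => decide (c i ≤ x (σ i)))
        (decide ((∀ j, κ j = true → cs j ≤ x (ρ j)) ∨ (∀ j, κ j = false → cs j ≤ x (ρ j)))) = true) B C := by
  have hcard : (0 : ℝ) < Fintype.card (Fin d → Equiv.Perm (Fin 3)) := by exact_mod_cast Fintype.card_pos
  have h := latticeE3_symm g (univ.filter fun x : Xd d K' => catEval K ops (fun i => decide (c i ≤ x (σ i)))
        (decide ((∀ j, κ j = true → cs j ≤ x (ρ j)) ∨ (∀ j, κ j = false → cs j ≤ x (ρ j)))) = true) B C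
  have hsum : 0 ≤ ∑ ω : Fin 3 → Xd d K', (∏ cc, ∏ a, g a (ω cc a)) *
      (Ssym (univ.filter fun x : Xd d K' => catEval K ops (fun i => decide (c i ≤ x (σ i)))
        (decide ((∀ j, κ j = true → cs j ≤ x (ρ j)) ∨ (∀ j, κ j = false → cs j ≤ x (ρ j)))) = true) B C ω : ℝ) :=
    Finset.sum_nonneg fun ω _ => mul_nonneg (Finset.prod_nonneg fun cc _ => Finset.prod_nonneg fun a _ => hg a _)
      (by exact_mod_cast Ssym_nonneg_caterpillarSeed K ops c σ κ cs ρ hσ hρ hσρ hB hC ω)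
  rw [← h] at hsum
  exact (mul_nonneg_iff_of_pos_left hcard).1 hsum

/-- **KAHN'S `E₃ ≥ 0` FOR A CATERPILLAR GROWN FROM AN OR OF TWO MONOMIALS** (probability form, every grid): for every product probability
weight `⊗ g_i` on `[K'+1]^d`, a read-once monotone formula `F = ℓ₀ ⋄₀ (ℓ₁ ⋄₁ ( ⋯ (ℓ_{K-1} ⋄_{K-1} (M₁ ∨ M₂))))` with threshold literals
`ℓ_i = [c i ≤ x (σ i)]`, connectives `ops i` (`true` = ∨), and monomials `M₁ = ⋀_{κ j} [cs j ≤ x (ρ j)]`, `M₂ = ⋀_{¬κ j} [cs j ≤ x (ρ j)]`,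
all coordinates `σ i, ρ j` distinct, and all increasing events `B, C`:  `0 ≤ E₃(1_A, 1_B, 1_C)` for `A = {x : F(x)}`
(e.g. `A = {x₁ ∧ (x₂x₃ ∨ x₄x₅)}`). [this work] -/
theorem sahiE_three_caterpillarSeed_nonneg (g : Fin d → Fin (K' + 1) → ℝ) (hg0 : ∀ i v, 0 ≤ g i v) (hg1 : ∀ i, ∑ v, g i v = 1)
    (K : ℕ) (ops : Fin K → Bool) (c : Fin K → Fin (K' + 1)) (σ : Fin K → Fin d)
    {K₀ : ℕ} (κ : Fin K₀ → Bool) (cs : Fin K₀ → Fin (K' + 1)) (ρ : Fin K₀ → Fin d)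
    (hσ : Function.Injective σ) (hρ : Function.Injective ρ) (hσρ : ∀ i j, σ i ≠ ρ j)
    {B C : Finset (Xd d K')} (hB : IsUpperSet (B : Set (Xd d K'))) (hC : IsUpperSet (C : Set (Xd d K'))) :
    0 ≤ sahiE (fun ω : Xd d K' => ∏ i, g i (ω i)) 3
      ![setInd (univ.filter fun x : Xd d K' => catEval K ops (fun i => decide (c i ≤ x (σ i)))
        (decide ((∀ j, κ j = true → cs j ≤ x (ρ j)) ∨ (∀ j, κ j = false → cs j ≤ x (ρ j)))) = true), setInd B, setInd C] := by
  classical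
  have hsum : ∑ ω : Fin d → Fin (K' + 1), ∏ i, g i (ω i) = 1 := by
    rw [← Fintype.prod_sum]; simp [hg1]
  rw [sahiE_three_indicator_eq_latticeE3 hsum]
  exact latticeE3_gridProd_nonneg_caterpillarSeed g hg0 K ops c σ κ cs ρ hσ hρ hσρ hB hC

end Summit.CriticalPhenomena.PercolationContinuityZ3.Theorems.SahiGridPattern
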